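import Literature.MathematicalPhysics.QuantumLattice.DWaveSourceWindowCertificateFieldRows
import Summits.Ventures.CertifiedManyBodySolver.Rows.SourcedGSClassNodeShapes
import HarnessLib

/-!
# PINNING-FIELD rows: GROUND-STATE-CLASS node shapes of «KKT + energy window» / «chord ⊕ KKT» pair legs, the energy rows
# fed by the cell's uniform CELLS (a cap cell at the program's field, floor cells at any fields)

HONEST FRAMING: soundness glue; no certificate, no number, no order parameter, no phase word. A finite-`h` response bound is a
response, never an order parameter (cell hubbard-cq wording W1).

WHAT THIS FILE IS (cell hubbard-cq, D-0082 (c) / LADDER row PC-a, seat hubbard-cq-obsth-1 «pinning-field K5 menu nodes with the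
pinning term»). `Rows/SourcedGSClassNodeShapes` reads a K-leg with ONE energy row (the cap at the program's field `h`). The legs the
cell's census keeps alive are «KKT + ENERGY WINDOW» (K1a+E: a floor row at the same field) and, by the same token, «CHORD ⊕ KKT»
(a floor row at a SMALLER field `h₁`, which with the cap at `h` is the Griffiths chord inside the SDP, so the ground-state rows can only
lift the chord floor of record). The reader is `Literature/…/DWaveSourceWindowCertificateFieldRows` (hubbard-cq-obsth-1 g5): floor rows
`Σⱼ κⱼ (Γ E^{src}_{μ,hⱼ} − ℓⱼ·1)` at arbitrary fields are valid in EVERY translation-invariant state once `ℓⱼ ≤ E(hⱼ)`. Here the rows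
are fed by CELLS: the cap by `SourcedEnergyUpperRow tp U μ h q L₀ u`, each floor by `SourcedEnergyLowerRow tp U μ hⱼ qⱼ L₀ⱼ ℓⱼ`
(`q, qⱼ ≥ 1`; hubbard-cq-obsth-2's `SourcedEnergyUpperRow.dWaveSourceEnergyDensityTT'_le` / `SourcedEnergyLowerRow.le_dWaveSourceEnergyDensityTT'`):

* `gsClass_re_expect_localPairAt_ge_of_twistedFlip_certificate_kkt_of_energyRows` — `∀ σ` translation-invariant ground state of
  `Φ − μn − hP_d`, `m ≤ Re σ(P₀^d)` (slot `2m ≤ c − Σ‖aₖ‖`);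
* `gsClass_neg_leftDeriv_ge_of_twistedFlip_certificate_kkt_of_energyRows` — STATE-FREE `m ≤ −∂⁻E(h)/2` (the chords' object).

Identity shape: CONSUMER-GRAMMAR-KKT.md §10 + the field-row block (§12): pair MIN objective, constant `c`, cap row
`κ⁺ ((u:ℚ)·1 − Γ E^{src}_h)`, floor rows `− Σ_{j∈J} κⱼ • (Γ E^{src}_{hⱼ} − (ℓⱼ:ℚ)•1)`, NO filling / unsourced rows (grand-canonical), RHS
`gramForm + (eom + flip-twisted defects) + (anti-Hermitian + words) + kktForm`. Interface note: no local instance, no definition, no named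
fact, no `sorry`.

References: R. B. Griffiths, Phys. Rev. 152 (1966) 240 §II [Griffiths1966]; J. Wang et al., PRX 14 (2024) 031006 §III [WangEtAl2024];
T. Koma, H. Tasaki, J. Stat. Phys. 76 (1994) 745 §1 [KomaTasaki1994]; M. Araújo et al., arXiv:2311.18707 §3.2 Prop. 11 [AraujoEtAl2023].
-/

noncomputable section

namespace Summit.Ventures.CertifiedManyBodySolver

open Literature.MathematicalPhysics.QuantumLattice Literature.MathematicalPhysics.QuantumLattice.ThermodynamicLimit
open Literature.MathematicalPhysics.QuantumManyBody.StateRelaxation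
open Matrix HubbardWave0 Literature.Probability.LatticeModels Finset InfVolFermionState
open scoped BigOperators ComplexOrder

variable {tp U μ h : ℝ}

/-- **«KKT + ENERGY ROWS» FLOOR NODE SHAPE, on the ground-state class**: a grand-canonical flip-twisted sourced window certificate with
ground-state rows, pair MIN objective, a cap row `κ⁺ ((u:ℚ)·1 − Γ E^{src}_h)` (`κ⁺ ≥ 0`) fed by a cap cell `SourcedEnergyUpperRow tp U μ h q L₀ u`,
and floor rows `Σⱼ κⱼ (Γ E^{src}_{hⱼ} − (ℓⱼ:ℚ)·1)` (`κⱼ ≥ 0`, any fields `hⱼ` — the same field for a window, a smaller one for a chord) fed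
by floor cells `SourcedEnergyLowerRow tp U μ (hⱼ) (qⱼ) (L₀ⱼ) (ℓⱼ)`, slot `2m ≤ c − Σ‖aₖ‖`, proves `∀ σ` in the class, `m ≤ Re σ(P₀^d)`.
[cite: Griffiths1966, §II] [cite: WangEtAl2024, §III] [cite: KomaTasaki1994, §1] -/
theorem gsClass_re_expect_localPairAt_ge_of_twistedFlip_certificate_kkt_of_energyRows (tp U μ h : ℝ)
    {Λ Λ' : Finset (Site 2)} (hΛ : Λ ⊆ Λ') (h8 : thicken Λ 1 ⊆ Λ') (h0 : thicken ({0} : Finset (Site 2)) 1 ⊆ Λ')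
    (hP : pairRegion (insert (0 : Site 2) unitSteps) 0 ⊆ Λ') {κp : ℝ} (hκ : 0 ≤ κp) {u : ℚ} {q L₀ : ℕ} (hq : 0 < q)
    (hrow : SourcedEnergyUpperRow tp U μ h q L₀ u)
    {J : Type*} (Jf : Finset J) (κf hf : J → ℝ) (lf : J → ℚ) (qf Lf : J → ℕ) (hκf : ∀ j ∈ Jf, 0 ≤ κf j)
    (hqf : ∀ j ∈ Jf, 0 < qf j) (hrows : ∀ j ∈ Jf, SourcedEnergyLowerRow tp U μ (hf j) (qf j) (Lf j) (lf j))
    {m : Type*} [Fintype m] [DecidableEq m] {Λm : Matrix m m ℂ} (hΛm : Λm.PosSemidef) (O : m → FermionOp Λ')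
    {κ' : Type*} (s : Finset κ') (B : κ' → FermionOp Λ)
    {ι : Type*} (tt : Finset ι) (γ : ι → DihedralGroup 4) (wv : ι → Site 2) (fl mt : ι → Fin 2)
    (hsh : ∀ l, d4ShiftSet (γ l) (wv l) Λ ⊆ Λ') (bb : ι → ℂ) (yw : ι → List (Orb (PolySite Λ) × Bool))
    {δ : Type*} (ah : Finset δ) (dc : δ → ℝ) (V : δ → FermionOp Λ')
    {κ'' : Type*} (w : Finset κ'') (a : κ'' → ℂ) (word : κ'' → List (Orb (PolySite Λ') × Bool))
    {β : Type*} [Fintype β] [DecidableEq β] {G : Matrix β β ℂ} (hG : G.PosSemidef) (Bk : β → FermionOp Λ) {c mfl : ℝ}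
    (hm : 2 * mfl ≤ c - ∑ k ∈ w, ‖a k‖)
    (hcert : (fermionEmbed (PolySite.incl hP) (localPairAt (insert (0 : Site 2) unitSteps) dWaveFormFactor 0) +
          (fermionEmbed (PolySite.incl hP) (localPairAt (insert (0 : Site 2) unitSteps) dWaveFormFactor 0))ᴴ) -
        (c : ℂ) • (1 : FermionOp Λ') -
        ((κp : ℝ) : ℂ) • ((((u : ℚ) : ℝ) : ℂ) • (1 : FermionOp Λ') -
          fermionEmbed (PolySite.incl h0) ((hubbardTTPrimeSourcedInteraction 1 tp U μ dWaveFormFactor h).meanEnergyObs 1)) -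
        ∑ j ∈ Jf, ((κf j : ℝ) : ℂ) •
          (fermionEmbed (PolySite.incl h0) ((hubbardTTPrimeSourcedInteraction 1 tp U μ dWaveFormFactor (hf j)).meanEnergyObs 1) -
            (((lf j : ℚ) : ℝ) : ℂ) • (1 : FermionOp Λ')) =
      gramForm Λm O +
        (∑ k ∈ s, (pairSourceWindowHamiltonianTT' dWaveFormFactor Λ' tp U μ h * fermionEmbed (PolySite.incl hΛ) (B k) -
            fermionEmbed (PolySite.incl hΛ) (B k) * pairSourceWindowHamiltonianTT' dWaveFormFactor Λ' tp U μ h) +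
          ∑ l ∈ tt, bb l • (gaugePhase (twistFlipExp (γ l) (fl l) (mt l)) (yw l) •
              fermionEmbed (PolySite.incl (hsh l))
                (fermionEmbed (PolySite.d4Emb (γ l) (wv l) Λ) (spinSwapIter (fl l).val (ladderWord (yw l)))) -
            fermionEmbed (PolySite.incl hΛ) (ladderWord (yw l)))) +
        (∑ m' ∈ ah, ((dc m' : ℝ) : ℂ) • ((V m')ᴴ - V m') + ∑ k ∈ w, a k • ladderWord (word k)) +
        kktForm (pairSourceWindowHamiltonianTT' dWaveFormFactor Λ' tp U μ h) G
          (fun b' => fermionEmbed (PolySite.incl hΛ) (Bk b'))) :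
    ∀ σ : InfVolFermionState 2, σ.IsMeanEnergyMinimiser (hubbardTTPrimeSourcedInteraction 1 tp U μ dWaveFormFactor h) 1 →
      mfl ≤ (σ.expect (pairRegion (insert (0 : Site 2) unitSteps) 0)
        (localPairAt (insert (0 : Site 2) unitSteps) dWaveFormFactor 0)).re := by
  intro σ hσ
  have hz : (0 : Site 2) ∈ Λ' := h0 (subset_thicken _ _ (Finset.mem_singleton_self 0))
  have hu : dWaveSourceEnergyDensityTT' tp U μ h ≤ ((u : ℚ) : ℝ) := hrow.dWaveSourceEnergyDensityTT'_le hq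
  have hF : ∀ σ' : InfVolFermionState 2, σ'.IsTranslationInvariant → σ'.density = σ.density →
      ∀ j ∈ Jf, κf j * ((lf j : ℚ) : ℝ) ≤
        κf j * σ'.meanEnergy (hubbardTTPrimeSourcedInteraction 1 tp U μ dWaveFormFactor (hf j)) 1 :=
    fun σ' hσ' _ j hj => mul_le_mul_meanEnergy_sourced_of_dWaveSourceEnergyDensityTT'_ge (hκf j hj)
      ((hrows j hj).le_dWaveSourceEnergyDensityTT' (hqf j hj)) σ' hσ'
  have hcert' : (fermionEmbed (PolySite.incl hP) (localPairAt (insert (0 : Site 2) unitSteps) dWaveFormFactor 0) +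
          (fermionEmbed (PolySite.incl hP) (localPairAt (insert (0 : Site 2) unitSteps) dWaveFormFactor 0))ᴴ) -
        (c : ℂ) • (1 : FermionOp Λ') -
        ∑ σ : Fin 2, (((0 : ℝ) : ℝ) : ℂ) • (nAt 0 hz σ - (((0 : ℝ) : ℝ) : ℂ) • (1 : FermionOp Λ')) -
        ((κp : ℝ) : ℂ) • ((((u : ℚ) : ℝ) : ℂ) • (1 : FermionOp Λ') -
          fermionEmbed (PolySite.incl h0) ((hubbardTTPrimeSourcedInteraction 1 tp U μ dWaveFormFactor h).meanEnergyObs 1)) -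
        (((0 : ℝ) : ℝ) : ℂ) • (fermionEmbed (PolySite.incl h0) ((hubbardTTPrimeFermionInteraction 1 tp U).meanEnergyObs 1) -
          (((0 : ℝ) : ℝ) : ℂ) • (1 : FermionOp Λ')) -
        ∑ j ∈ Jf, ((κf j : ℝ) : ℂ) •
          (fermionEmbed (PolySite.incl h0) ((hubbardTTPrimeSourcedInteraction 1 tp U μ dWaveFormFactor (hf j)).meanEnergyObs 1) -
            ((((lf j : ℚ) : ℝ) : ℝ) : ℂ) • (1 : FermionOp Λ')) =
      gramForm Λm O +
        (∑ k ∈ s, (pairSourceWindowHamiltonianTT' dWaveFormFactor Λ' tp U μ h * fermionEmbed (PolySite.incl hΛ) (B k) -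
            fermionEmbed (PolySite.incl hΛ) (B k) * pairSourceWindowHamiltonianTT' dWaveFormFactor Λ' tp U μ h) +
          ∑ l ∈ tt, bb l • (gaugePhase (twistFlipExp (γ l) (fl l) (mt l)) (yw l) •
              fermionEmbed (PolySite.incl (hsh l))
                (fermionEmbed (PolySite.d4Emb (γ l) (wv l) Λ) (spinSwapIter (fl l).val (ladderWord (yw l)))) -
            fermionEmbed (PolySite.incl hΛ) (ladderWord (yw l)))) +
        (∑ m' ∈ ah, ((dc m' : ℝ) : ℂ) • ((V m')ᴴ - V m') + ∑ k ∈ w, a k • ladderWord (word k)) +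
        kktForm (pairSourceWindowHamiltonianTT' dWaveFormFactor Λ' tp U μ h) G
          (fun b' => fermionEmbed (PolySite.incl hΛ) (Bk b')) := by
    simp only [Complex.ofReal_zero, zero_smul, Finset.sum_const_zero, sub_zero]
    exact hcert
  have hmain := hσ.le_two_mul_re_expect_localPairAt_of_twistedFlip_certificate_kkt_fieldRows hΛ h8 h0 hz hP κp 0 ((u : ℚ) : ℝ) 0
    (fun _ => 0) 0 (hσ.mul_meanEnergy_sourced_le_of_le hκ hu) (fun _ _ _ => by simp only [zero_mul, le_refl]) Jf κf hf
    (fun j => ((lf j : ℚ) : ℝ)) hF hΛm O s B tt γ wv fl mt hsh bb yw ah dc V w a word hG Bk hcert'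
  simp only [Finset.sum_const_zero, zero_mul, add_zero] at hmain
  linarith

/-- **«KKT + ENERGY ROWS» FLOOR, STATE-FREE (Griffiths' left edge)**: the same certificate and cells prove `m ≤ −∂⁻E(h)/2`,
`E = dWaveSourceEnergyDensityTT' tp U μ` — directly comparable with the chord floor at the same field. [cite: Griffiths1966, §II]
[cite: KomaTasaki1994, §1] -/
theorem gsClass_neg_leftDeriv_ge_of_twistedFlip_certificate_kkt_of_energyRows (tp U μ h : ℝ)
    {Λ Λ' : Finset (Site 2)} (hΛ : Λ ⊆ Λ') (h8 : thicken Λ 1 ⊆ Λ') (h0 : thicken ({0} : Finset (Site 2)) 1 ⊆ Λ')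
    (hP : pairRegion (insert (0 : Site 2) unitSteps) 0 ⊆ Λ') {κp : ℝ} (hκ : 0 ≤ κp) {u : ℚ} {q L₀ : ℕ} (hq : 0 < q)
    (hrow : SourcedEnergyUpperRow tp U μ h q L₀ u)
    {J : Type*} (Jf : Finset J) (κf hf : J → ℝ) (lf : J → ℚ) (qf Lf : J → ℕ) (hκf : ∀ j ∈ Jf, 0 ≤ κf j)
    (hqf : ∀ j ∈ Jf, 0 < qf j) (hrows : ∀ j ∈ Jf, SourcedEnergyLowerRow tp U μ (hf j) (qf j) (Lf j) (lf j))
    {m : Type*} [Fintype m] [DecidableEq m] {Λm : Matrix m m ℂ} (hΛm : Λm.PosSemidef) (O : m → FermionOp Λ')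
    {κ' : Type*} (s : Finset κ') (B : κ' → FermionOp Λ)
    {ι : Type*} (tt : Finset ι) (γ : ι → DihedralGroup 4) (wv : ι → Site 2) (fl mt : ι → Fin 2)
    (hsh : ∀ l, d4ShiftSet (γ l) (wv l) Λ ⊆ Λ') (bb : ι → ℂ) (yw : ι → List (Orb (PolySite Λ) × Bool))
    {δ : Type*} (ah : Finset δ) (dc : δ → ℝ) (V : δ → FermionOp Λ')
    {κ'' : Type*} (w : Finset κ'') (a : κ'' → ℂ) (word : κ'' → List (Orb (PolySite Λ') × Bool))
    {β : Type*} [Fintype β] [DecidableEq β] {G : Matrix β β ℂ} (hG : G.PosSemidef) (Bk : β → FermionOp Λ) {c mfl : ℝ}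
    (hm : 2 * mfl ≤ c - ∑ k ∈ w, ‖a k‖)
    (hcert : (fermionEmbed (PolySite.incl hP) (localPairAt (insert (0 : Site 2) unitSteps) dWaveFormFactor 0) +
          (fermionEmbed (PolySite.incl hP) (localPairAt (insert (0 : Site 2) unitSteps) dWaveFormFactor 0))ᴴ) -
        (c : ℂ) • (1 : FermionOp Λ') -
        ((κp : ℝ) : ℂ) • ((((u : ℚ) : ℝ) : ℂ) • (1 : FermionOp Λ') -
          fermionEmbed (PolySite.incl h0) ((hubbardTTPrimeSourcedInteraction 1 tp U μ dWaveFormFactor h).meanEnergyObs 1)) -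
        ∑ j ∈ Jf, ((κf j : ℝ) : ℂ) •
          (fermionEmbed (PolySite.incl h0) ((hubbardTTPrimeSourcedInteraction 1 tp U μ dWaveFormFactor (hf j)).meanEnergyObs 1) -
            (((lf j : ℚ) : ℝ) : ℂ) • (1 : FermionOp Λ')) =
      gramForm Λm O +
        (∑ k ∈ s, (pairSourceWindowHamiltonianTT' dWaveFormFactor Λ' tp U μ h * fermionEmbed (PolySite.incl hΛ) (B k) -
            fermionEmbed (PolySite.incl hΛ) (B k) * pairSourceWindowHamiltonianTT' dWaveFormFactor Λ' tp U μ h) +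
          ∑ l ∈ tt, bb l • (gaugePhase (twistFlipExp (γ l) (fl l) (mt l)) (yw l) •
              fermionEmbed (PolySite.incl (hsh l))
                (fermionEmbed (PolySite.d4Emb (γ l) (wv l) Λ) (spinSwapIter (fl l).val (ladderWord (yw l)))) -
            fermionEmbed (PolySite.incl hΛ) (ladderWord (yw l)))) +
        (∑ m' ∈ ah, ((dc m' : ℝ) : ℂ) • ((V m')ᴴ - V m') + ∑ k ∈ w, a k • ladderWord (word k)) +
        kktForm (pairSourceWindowHamiltonianTT' dWaveFormFactor Λ' tp U μ h) G
          (fun b' => fermionEmbed (PolySite.incl hΛ) (Bk b'))) :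
    mfl ≤ -derivWithin (dWaveSourceEnergyDensityTT' tp U μ) (Set.Iio h) h / 2 := by
  have hu : dWaveSourceEnergyDensityTT' tp U μ h ≤ ((u : ℚ) : ℝ) := hrow.dWaveSourceEnergyDensityTT'_le hq
  have hlf : ∀ j ∈ Jf, (fun j => ((lf j : ℚ) : ℝ)) j ≤ dWaveSourceEnergyDensityTT' tp U μ (hf j) :=
    fun j hj => (hrows j hj).le_dWaveSourceEnergyDensityTT' (hqf j hj)
  have hmain := neg_leftDeriv_dWaveSourceEnergyDensityTT'_ge_of_gs_certificate_kkt_fieldRows tp U μ h hΛ h8 h0 hP hκ hu Jf κf hf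
    (fun j => ((lf j : ℚ) : ℝ)) hκf hlf hΛm O s B tt γ wv fl mt hsh bb yw ah dc V w a word hG Bk hcert
  linarith

end Summit.Ventures.CertifiedManyBodySolver

end
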